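/-
Copyright (c) 2026 the pub-hodgecm-mathlib formalisation cell (harness21).  Prover seat hodgecm-mathlib-R90-C10-p07 (g3), SLAB R90-TF, section S1 «Ch10-local», U4Keys :182 wild
corner (S-W), card «(W-3b)-CM twin» (dealer R-S1-40 2026-09-05T03:43:17Z, line lead R90-C10-p05 (g3) «SPLIT» 03:44:24Z): the CM dress (`U(Φ₃)(L⁺_v)`, `(L ⊗ L⁺_v)ˣ`-characters) of
★ (W-3b) `R90S1WildConcaveLevelDatumRb` §2 — `θ(g) := χ₁(g₀₀)` multiplicative on `J_e` for ANY trace-one `t ∈ L_w` in the DEFECT currency `|t|·|ϖ|^δ ≤ 1`, general `σ`-fixed level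
`c` — over ★ (W-0b) `theta_mul_concave_ofRecord`.  THEOREMS ONLY.  NOT THE PAYER of :182.
-/
import Summits.HodgeConjecture.HodgeConjecture.Theorems.R90S1WildConcaveLevelMinOfRecord   -- ★ (W-0b) p865156 (this seat): `chi_unit_apply_zero_zero_mul_concave_ofRecord`, `theta_mul_concave_ofRecord`; brings the CM frame of ★ p862709 and ★ (W-0)
import Summits.HodgeConjecture.HodgeConjecture.Theorems.R90S1WildConcaveLevelDatumRa       -- ★ (W-3) p865143 (R90-C10-p05 (g3)): `v_mul_pow_le_pow_of_defect` (defect letter ⇒ the two `|t|`-weighted letters)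
import HarnessLib

/-!
# R90 · S1 ∕ U4Keys :182, THE WILD CORNER (S-W) — the (W-3b)-CM twin: `θ(g) = χ₁(g₀₀)` IS MULTIPLICATIVE ON `J_e = eA⁻¹(Jg)` IN THE DEFECT CURRENCY
# «any trace-one `t ∈ L_w` with `|t|·|ϖ|^δ ≤ 1`, `σ`-fixed level `c`, exponents `n ≤ r₁ + r₂`, `n + δ ≤ s₁ + 2r₂`, `n + δ ≤ s₂ + 2r₁`, `c ≤ s₁ + s₂`; (R-b) datum `(⌊n∕2⌋, δ; ⌈n∕2⌉, δ + 1)`»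
# [Tits1979 §1.15; BruhatTits1972 (4.4.4), (6.4.9); Roche1998 §3; MoyPrasad1996 §3; Serre1979 III §3, V §3; PlatonovRapinchuk1994 §5.1]

Cell `pub/hodgecm-mathlib` (D-0151), SLAB R90-TF, section S1, crux H413 = `stmt-HodgeConjecture-24833` (lane `--supports … --as helper`), route of record `HCCMUnconditional`;
prover seat `hodgecm-mathlib-R90-C10-p07` (g3).  THEOREMS ONLY (no `def` ∕ `instance` ∕ `notation` ∕ named-fact hypothesis ∕ `sorry`).  NOT THE PAYER of :182 — the `hθmul`
ORGAN, CM side, of the WILD DETERMINANT ROAD (producer of the (S-W) letter `HWRb` of ★ (W-5) `R90S1KeysThmTwoPosDepthWildLeafOfRecord`; sub-branch (R-b): Branch B, `χ₁` non-trivial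
on the `σ`-fixed units), and — at `c := 1` — of its (R-a) sibling (R90-C10-p03 (g2) `R90S1WildThetaMulFixTrivialDefectCM`: ONE transport, his `hcondF_of_fixTrivial` feeds §1 here).

THE POINT.  ★ (W-0b) `theta_mul_concave_ofRecord` makes `θ(g) := if h : IsUnit g₀₀ then χ₁(h.unit) else 0` multiplicative on `Je = eA⁻¹(Jg)` for `χ₁ : (L ⊗ L⁺_v)ˣ → ℂˣ` of
E-conductor `≤ n` (`hcond`) and F-conductor `≤ c` on the `(c ⊗ 1)`-fixed units (`hcondF`), given ANY trace-one `t ∈ L_w` and the two `|t|`-WEIGHTED inequalities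
`|t|·|ϖ|^{e 0 2 + 2·e 1 0} ≤ |ϖ|ⁿ`, `|t|·|ϖ|^{e 2 0 + 2·e 0 1} ≤ |ϖ|ⁿ`.  The wild line's letter of record for `|t|` is the DEFECT bound `hδ : |t|·|ϖ|^δ ≤ 1` (`δ = d − 1` at a wild
place — ★ (W-0) minimal `t` + R90-C10-p01 (g4)'s bridge `R90S1WildTraceMinDefect`; `δ = 0`, `t` integral, elsewhere), under which the weighted inequalities follow from the
ℕ-inequalities `n + δ ≤ e 0 2 + 2·e 1 0`, `n + δ ≤ e 2 0 + 2·e 0 1` (★ (W-3) `v_mul_pow_le_pow_of_defect`).  §1 is ★ (W-0b) §4 in that currency (general `e`, general `c` — the CM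
twin of ★ (W-3b) §2 `chi_apply_zero_zero_mul_of_fixCond_of_defect`); §2 reads it at Roche's two-depth matrix `e = (0, r₁, s₁; r₂, 0, r₁; s₂, r₂, 0)` in the `∀ x ∈ Je, ∀ y ∈ Je` shape
of the type-basis letter `hθmul` (the DEFECT twin of ★ `R90S1BposCongruencePackTheta.theta_mul_twoDepth`); §3 is the (R-b) DATUM OF RECORD `(r₁, s₁; r₂, s₂) = (⌊n∕2⌋, δ; ⌈n∕2⌉, δ + 1)`
(★ (W-3b) §1: the tame Branch-B datum `(ν, 0; ν, 1)` shifted by the defect), where all four exponent inequalities are AUTOMATIC and the only surviving letters are `hcond`, `hcondF` at a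
level `c ≤ 2δ + 1` (in (R-b): `c = 2d − 1`, ★ (W-2) `R90S1WildUnitNormIndex`), `ht`, `hδ` and `1 ≤ n` — D174's concavity (needed only to BUILD `Jg`, the consumer's act via ★
`exists_subgroup_forall_mem_iff_twoDepth`) holds there iff `δ + 1 ≤ n`, automatic in (R-b) (`n ≥ 2δ + 1`).
* §1 **`chi_unit_apply_zero_zero_mul_of_fixCond_of_defect`**, **`theta_mul_of_fixCond_of_defect`** (general `e`, `c`; (R-a) = `c := 1` with p03's `hcondF_of_fixTrivial`).
* §2 **`theta_mul_twoDepth_of_defect`** (`e = (0, r₁, s₁; r₂, 0, r₁; s₂, r₂, 0)`, `∀ x ∈ Je, ∀ y ∈ Je`).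
* §3 **`theta_mul_twoDepth_wildRb`** (the (R-b) datum `(⌊n∕2⌋, δ; ⌈n∕2⌉, δ + 1)`: letters `hcond`, `hcondF`@`c ≤ 2δ+1`, `ht`, `hδ`, `1 ≤ n` only).
HONEST FLAG.  θ-MULTIPLICATIVE ≠ TYPE: nothing here claims `dim i(χ₁,1)^{(J_e, θ)} = 2`; the wild cell ∕ witness cover of the determinant road is a separate, unbuilt brick (K2E3-p34 (g3)
census (a): M).  HONEST LABEL: HC_CM is proved only modulo the 7 printed citations (2 remaining named inputs: hLiu418 = `stmt-HodgeConjecture-24832`, h413 = `stmt-HodgeConjecture-24833`)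
until rung 0 closes; count-neutral — this file pays no socket and closes nothing ((S-W) stays the XL residual of :182); no printed citation is discharged; REL ≠ ★ ≠ BUILT.

## References
* [Tits1979] J. Tits, *Reductive groups over local fields*, Proc. Sympos. Pure Math. 33.1 (1979), §1.15 (the ramified quasi-split `SU₃`, the trace constant).
* [BruhatTits1972] F. Bruhat, J. Tits, *Groupes réductifs sur un corps local I*, Publ. Math. IHÉS 41 (1972), (4.4.4), (6.4.9).
* [Roche1998] A. Roche, *Types and Hecke algebras for principal series representations of split reductive p-adic groups*, Ann. Sci. ÉNS (4) 31 (1998), §3, Lemma 3.2.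
* [MoyPrasad1996] A. Moy, G. Prasad, *Jacquet functors and unrefined minimal K-types*, Comment. Math. Helv. 71 (1996), §3.
* [Serre1979] J.-P. Serre, *Local Fields*, GTM 67 (1979), Ch. III §3 Prop. 7 (the defect `δ = d − 1`), Ch. V §3 (conductor of `ω_{E∕F}` is `d`).
* [PlatonovRapinchuk1994] V. Platonov, A. Rapinchuk, *Algebraic Groups and Number Theory* (1994), §5.1 (the one-place model at a non-split place).
-/

set_option autoImplicit false
-- the mandated namespace has the single-problem summit's repeated segment (`HodgeConjecture.HodgeConjecture`)
set_option linter.dupNamespace false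

noncomputable section

open NumberField IsDedekindDomain
open scoped Matrix MatrixGroups WithZero Valued
open Literature.NumberTheory Literature.NumberTheory.Automorphic Literature.NumberTheory.Automorphic.UnitaryGroup
open Literature.NumberTheory.Rogawski1990

namespace Summit.HodgeConjecture.HodgeConjecture.R90.S1.WildThetaMulFixCondDefectCM

open Summit.HodgeConjecture.HodgeConjecture.Cruxes.H413
open Summit.HodgeConjecture.HodgeConjecture.R90.S1.WildConcaveLevelMinOfRecord

variable (L : Type) [Field L] [NumberField L] [IsCMField L] (v : HeightOneSpectrum (𝓞 ↥(maximalRealSubfield L)))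
  (w : PlacesOver L v) (hw : IsCMField.complexConj L • w.1 = w.1)
  (eA : Gqs L v ≃ₜ* ↥(unitaryGroupOfForm (galAdicCompletionMap (L := L) (IsCMField.complexConj L) hw) ((StdForm.antidiagonal 3).over (w.1.adicCompletion L))))
  (heA : ∀ g : Gqs L v,
    ((eA g : ↥(unitaryGroupOfForm (galAdicCompletionMap (L := L) (IsCMField.complexConj L) hw) ((StdForm.antidiagonal 3).over (w.1.adicCompletion L)))) :
        GL (Fin 3) (w.1.adicCompletion L)) =
      ((localNonsplitEquiv (IsCMField.complexConj L) (qsForm L) (IsCMField.complexConj_ne_one L) w hw g :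
        ↥(unitaryGroupOfForm (galAdicCompletionMap (L := L) (IsCMField.complexConj L) hw) (placeForm (qsForm L) w.1))) : GL (Fin 3) (w.1.adicCompletion L)))
  {ϖ : w.1.adicCompletion L} (hϖ : Valued.v ϖ = WithZero.exp (-1 : ℤ))

/-! ## §1 General exponent matrix `e`, general `σ`-fixed level `c`: ★ (W-0b) §4 in the defect currency -/

section General

variable (e : Fin 3 → Fin 3 → ℕ)
  (Jg : Subgroup ↥(unitaryGroupOfForm (galAdicCompletionMap (L := L) (IsCMField.complexConj L) hw) ((StdForm.antidiagonal 3).over (w.1.adicCompletion L))))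
  (hJg : ∀ k : ↥(unitaryGroupOfForm (galAdicCompletionMap (L := L) (IsCMField.complexConj L) hw) ((StdForm.antidiagonal 3).over (w.1.adicCompletion L))),
    k ∈ Jg ↔ ∀ i j, Valued.v (((k : GL (Fin 3) (w.1.adicCompletion L)) : Matrix (Fin 3) (Fin 3) (w.1.adicCompletion L)) i j) ≤ Valued.v ϖ ^ e i j)
  (Je : Subgroup (Gqs L v)) (hJe : Je = Jg.comap eA.toMulEquiv.toMonoidHom)

open Classical in
include heA hϖ hJg hJe in
set_option maxHeartbeats 400000 in
-- the statement's `IsUnit` binders on `L ⊗ L⁺_v`-valued matrix entries time out at `whnf` under the default 200000 (measured; class of ★ `K2E3ConcaveLevelIwahoriCharacterCM`)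
/-- **`χ₁((jj′)₀₀) = χ₁(j₀₀)·χ₁(j′₀₀)` ON `Je` IN THE DEFECT CURRENCY** (units form).  ★ (W-0b) `chi_unit_apply_zero_zero_mul_concave_ofRecord` with its two `|t|`-weighted letters
replaced by the DEFECT bound `hδ : |t|·|ϖ|^δ ≤ 1` and the ℕ-inequalities `n + δ ≤ e 0 2 + 2·e 1 0`, `n + δ ≤ e 2 0 + 2·e 0 1` (★ (W-3) `v_mul_pow_le_pow_of_defect`); every other binder
(`h10e h20e χ₁ hc1 hcond hcondF ht h1 h4 hj hj' h0 hu1 hu2`) and the conclusion VERBATIM.  The CM twin of ★ (W-3b) `chi_apply_zero_zero_mul_of_fixCond_of_defect` (minus `htmin`).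
[cite: Roche1998, §3] [cite: Tits1979, §1.15] [cite: Serre1979, Ch. III §3 Prop. 7] [cite: BruhatTits1972, (6.4.9)] [cite: PlatonovRapinchuk1994, §5.1] -/
theorem chi_unit_apply_zero_zero_mul_of_fixCond_of_defect (h10e : 1 ≤ e 1 0) (h20e : 1 ≤ e 2 0) (χ₁ : (LocalRing L v)ˣ →* ℂˣ) {n c δ : ℕ} (hc1 : 1 ≤ c)
    (hcond : ∀ u : (LocalRing L v)ˣ, (∀ w' : PlacesOver L v, Valued.v (((u : LocalRing L v) w') - 1) ≤ Valued.v ϖ ^ n) → χ₁ u = 1)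
    (hcondF : ∀ u : (LocalRing L v)ˣ, Units.map (conjLocal L (IsCMField.complexConj L) v : LocalRing L v →* LocalRing L v) u = u →
      (∀ w' : PlacesOver L v, Valued.v (((u : LocalRing L v) w') - 1) ≤ Valued.v ϖ ^ c) → χ₁ u = 1)
    {t : w.1.adicCompletion L} (ht : t + galAdicCompletionMap (L := L) (IsCMField.complexConj L) hw t = 1)
    (hδ : Valued.v t * Valued.v ϖ ^ δ ≤ 1)
    (h1 : n ≤ e 0 1 + e 1 0) (h2 : n + δ ≤ e 0 2 + 2 * e 1 0) (h3 : n + δ ≤ e 2 0 + 2 * e 0 1) (h4 : c ≤ e 0 2 + e 2 0)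
    {j j' : Gqs L v} (hj : j ∈ Je) (hj' : j' ∈ Je)
    (h0 : IsUnit ((((j * j').val : GL (Fin 3) (LocalRing L v)) : Matrix (Fin 3) (Fin 3) (LocalRing L v)) 0 0))
    (hu1 : IsUnit (((j.val : GL (Fin 3) (LocalRing L v)) : Matrix (Fin 3) (Fin 3) (LocalRing L v)) 0 0))
    (hu2 : IsUnit (((j'.val : GL (Fin 3) (LocalRing L v)) : Matrix (Fin 3) (Fin 3) (LocalRing L v)) 0 0)) :
    χ₁ h0.unit = χ₁ hu1.unit * χ₁ hu2.unit :=
  chi_unit_apply_zero_zero_mul_concave_ofRecord L v w hw eA heA hϖ e Jg hJg Je hJe h10e h20e χ₁ hc1 hcond hcondF ht h1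
    (WildConcaveLevelDatumRa.v_mul_pow_le_pow_of_defect hϖ hδ h2) (WildConcaveLevelDatumRa.v_mul_pow_le_pow_of_defect hϖ hδ h3) h4 hj hj' h0 hu1 hu2

open Classical in
include heA hϖ hJg hJe in
/-- **`θ(jj′) = θ(j)·θ(j′)` ON `Je` IN THE DEFECT CURRENCY — the `hθmul` letter, CM side, general `e` and `c`** (`θ(g) := if h : IsUnit g₀₀ then χ₁(h.unit) else 0`).  ★ (W-0b)
`theta_mul_concave_ofRecord` with `hT2 hT3` ↦ `(hδ : |t|·|ϖ|^δ ≤ 1) (h2 : n + δ ≤ e 0 2 + 2·e 1 0) (h3 : n + δ ≤ e 2 0 + 2·e 0 1)`, nothing else moved.  Sub-branch (R-a) is the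
instance `c := 1` (`hcondF` from `χ₁ = 1` on the fixed units of modulus one — R90-C10-p03 (g2)'s `hcondF_of_fixTrivial`); sub-branch (R-b) takes `c = 2d − 1 = 2δ + 1` (★ (W-2)).
[cite: Roche1998, §3] [cite: Tits1979, §1.15] [cite: Serre1979, Ch. III §3 Prop. 7] [cite: MoyPrasad1996, §3] [cite: BruhatTits1972, (6.4.9)] -/
theorem theta_mul_of_fixCond_of_defect (h10e : 1 ≤ e 1 0) (h20e : 1 ≤ e 2 0) (χ₁ : (LocalRing L v)ˣ →* ℂˣ) {n c δ : ℕ} (hc1 : 1 ≤ c)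
    (hcond : ∀ u : (LocalRing L v)ˣ, (∀ w' : PlacesOver L v, Valued.v (((u : LocalRing L v) w') - 1) ≤ Valued.v ϖ ^ n) → χ₁ u = 1)
    (hcondF : ∀ u : (LocalRing L v)ˣ, Units.map (conjLocal L (IsCMField.complexConj L) v : LocalRing L v →* LocalRing L v) u = u →
      (∀ w' : PlacesOver L v, Valued.v (((u : LocalRing L v) w') - 1) ≤ Valued.v ϖ ^ c) → χ₁ u = 1)
    {t : w.1.adicCompletion L} (ht : t + galAdicCompletionMap (L := L) (IsCMField.complexConj L) hw t = 1)
    (hδ : Valued.v t * Valued.v ϖ ^ δ ≤ 1)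
    (h1 : n ≤ e 0 1 + e 1 0) (h2 : n + δ ≤ e 0 2 + 2 * e 1 0) (h3 : n + δ ≤ e 2 0 + 2 * e 0 1) (h4 : c ≤ e 0 2 + e 2 0)
    {j j' : Gqs L v} (hj : j ∈ Je) (hj' : j' ∈ Je) :
    (if h : IsUnit ((((j * j').val : GL (Fin 3) (LocalRing L v)) : Matrix (Fin 3) (Fin 3) (LocalRing L v)) 0 0) then ((χ₁ h.unit : ℂˣ) : ℂ) else 0) =
      (if h : IsUnit (((j.val : GL (Fin 3) (LocalRing L v)) : Matrix (Fin 3) (Fin 3) (LocalRing L v)) 0 0) then ((χ₁ h.unit : ℂˣ) : ℂ) else 0) *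
        (if h : IsUnit (((j'.val : GL (Fin 3) (LocalRing L v)) : Matrix (Fin 3) (Fin 3) (LocalRing L v)) 0 0) then ((χ₁ h.unit : ℂˣ) : ℂ) else 0) :=
  theta_mul_concave_ofRecord L v w hw eA heA hϖ e Jg hJg Je hJe h10e h20e χ₁ hc1 hcond hcondF ht h1
    (WildConcaveLevelDatumRa.v_mul_pow_le_pow_of_defect hϖ hδ h2) (WildConcaveLevelDatumRa.v_mul_pow_le_pow_of_defect hϖ hδ h3) h4 hj hj'

end General

/-! ## §2 Roche's two-depth matrix `e = (0, r₁, s₁; r₂, 0, r₁; s₂, r₂, 0)`: the type-basis letter `hθmul` in the defect currency -/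

section TwoDepth

variable (r₁ s₁ r₂ s₂ : ℕ)
  (Jg : Subgroup ↥(unitaryGroupOfForm (galAdicCompletionMap (L := L) (IsCMField.complexConj L) hw) ((StdForm.antidiagonal 3).over (w.1.adicCompletion L))))
  (hJg : ∀ k : ↥(unitaryGroupOfForm (galAdicCompletionMap (L := L) (IsCMField.complexConj L) hw) ((StdForm.antidiagonal 3).over (w.1.adicCompletion L))),
    k ∈ Jg ↔ ∀ i j, Valued.v (((k : GL (Fin 3) (w.1.adicCompletion L)) : Matrix (Fin 3) (Fin 3) (w.1.adicCompletion L)) i j) ≤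
      Valued.v ϖ ^ (![![0, r₁, s₁], ![r₂, 0, r₁], ![s₂, r₂, 0]] : Fin 3 → Fin 3 → ℕ) i j)
  (Je : Subgroup (Gqs L v)) (hJe : Je = Jg.comap eA.toMulEquiv.toMonoidHom)

open Classical in
include heA hϖ hJg hJe in
/-- **Letter `hθmul` in the defect currency: `θ(xy) = θ(x)·θ(y)` for `x, y ∈ J_e`** at Roche's two-depth matrix `e = (0, r₁, s₁; r₂, 0, r₁; s₂, r₂, 0)` with `1 ≤ r₂`, `1 ≤ s₂`,
for `χ₁ : (L ⊗ L⁺_v)ˣ → ℂˣ` with E-conductor `≤ n` (`hcond`) and F-conductor `≤ c` on the `(c ⊗ 1)`-fixed units (`hcondF`, `1 ≤ c`), ANY trace-one `t ∈ L_w` with `|t|·|ϖ|^δ ≤ 1`, and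
`n ≤ r₁ + r₂`, `n + δ ≤ s₁ + 2r₂`, `n + δ ≤ s₂ + 2r₁`, `c ≤ s₁ + s₂` — the DEFECT twin of ★ `R90S1BposCongruencePackTheta.theta_mul_twoDepth` (there: `|t| ≤ 1`, `δ = 0`, `c ≤ n`), in
the `∀ x ∈ Je, ∀ y ∈ Je` shape of the type-basis letter. [cite: Roche1998, §3, Lemma 3.2] [cite: Tits1979, §1.15] [cite: MoyPrasad1996, §3] [cite: BruhatTits1972, (6.4.9)] -/
theorem theta_mul_twoDepth_of_defect (h10 : 1 ≤ r₂) (h20 : 1 ≤ s₂) (χ₁ : (LocalRing L v)ˣ →* ℂˣ) {n c δ : ℕ} (hc1 : 1 ≤ c)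
    (hcond : ∀ u : (LocalRing L v)ˣ, (∀ w' : PlacesOver L v, Valued.v (((u : LocalRing L v) w') - 1) ≤ Valued.v ϖ ^ n) → χ₁ u = 1)
    (hcondF : ∀ u : (LocalRing L v)ˣ, Units.map (conjLocal L (IsCMField.complexConj L) v : LocalRing L v →* LocalRing L v) u = u →
      (∀ w' : PlacesOver L v, Valued.v (((u : LocalRing L v) w') - 1) ≤ Valued.v ϖ ^ c) → χ₁ u = 1)
    {t : w.1.adicCompletion L} (ht : t + galAdicCompletionMap (L := L) (IsCMField.complexConj L) hw t = 1)
    (hδ : Valued.v t * Valued.v ϖ ^ δ ≤ 1)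
    (h1 : n ≤ r₁ + r₂) (h2 : n + δ ≤ s₁ + 2 * r₂) (h3 : n + δ ≤ s₂ + 2 * r₁) (h4 : c ≤ s₁ + s₂) :
    ∀ x ∈ Je, ∀ y ∈ Je,
      (if h : IsUnit ((((x * y : Gqs L v).val : GL (Fin 3) (LocalRing L v)) : Matrix (Fin 3) (Fin 3) (LocalRing L v)) 0 0) then ((χ₁ h.unit : ℂˣ) : ℂ) else 0) =
        (if h : IsUnit (((x.val : GL (Fin 3) (LocalRing L v)) : Matrix (Fin 3) (Fin 3) (LocalRing L v)) 0 0) then ((χ₁ h.unit : ℂˣ) : ℂ) else 0) *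
          (if h : IsUnit (((y.val : GL (Fin 3) (LocalRing L v)) : Matrix (Fin 3) (Fin 3) (LocalRing L v)) 0 0) then ((χ₁ h.unit : ℂˣ) : ℂ) else 0) := by
  intro x hx y hy
  exact theta_mul_of_fixCond_of_defect L v w hw eA heA hϖ _ Jg hJg Je hJe (by simpa using h10) (by simpa using h20) χ₁ hc1 hcond hcondF ht hδ
    (by simpa using h1) (by simpa using h2) (by simpa using h3) (by simpa using h4) hx hy

end TwoDepth

/-! ## §3 The (R-b) datum of record `(r₁, s₁; r₂, s₂) = (⌊n∕2⌋, δ; ⌈n∕2⌉, δ + 1)`: every exponent inequality is automatic -/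

section WildRb

variable (n δ : ℕ)
  (Jg : Subgroup ↥(unitaryGroupOfForm (galAdicCompletionMap (L := L) (IsCMField.complexConj L) hw) ((StdForm.antidiagonal 3).over (w.1.adicCompletion L))))
  (hJg : ∀ k : ↥(unitaryGroupOfForm (galAdicCompletionMap (L := L) (IsCMField.complexConj L) hw) ((StdForm.antidiagonal 3).over (w.1.adicCompletion L))),
    k ∈ Jg ↔ ∀ i j, Valued.v (((k : GL (Fin 3) (w.1.adicCompletion L)) : Matrix (Fin 3) (Fin 3) (w.1.adicCompletion L)) i j) ≤
      Valued.v ϖ ^ (![![0, n / 2, δ], ![n - n / 2, 0, n / 2], ![δ + 1, n - n / 2, 0]] : Fin 3 → Fin 3 → ℕ) i j)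
  (Je : Subgroup (Gqs L v)) (hJe : Je = Jg.comap eA.toMulEquiv.toMonoidHom)

open Classical in
include heA hϖ hJg hJe in
/-- **`hθmul` AT THE (R-b) DATUM OF RECORD `e = (0, ⌊n∕2⌋, δ; ⌈n∕2⌉, 0, ⌊n∕2⌋; δ + 1, ⌈n∕2⌉, 0)`** — the tame Branch-B datum `(ν, 0; ν, 1)` shifted by the defect (★ (W-3b) §1): for
`χ₁ : (L ⊗ L⁺_v)ˣ → ℂˣ` with E-conductor `≤ n`, `1 ≤ n`, and F-conductor `≤ c` on the `(c ⊗ 1)`-fixed units at a level `1 ≤ c ≤ 2δ + 1` (in (R-b): `c = 2d − 1`, ★ (W-2)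
`R90S1WildUnitNormIndex`), and ANY trace-one `t ∈ L_w` with `|t|·|ϖ|^δ ≤ 1`: `θ(xy) = θ(x)·θ(y)` on `J_e`.  All of §2's exponent inequalities hold here by arithmetic
(`n ≤ ⌊n∕2⌋ + ⌈n∕2⌉`, `n + δ ≤ δ + 2⌈n∕2⌉`, `n + δ ≤ δ + 1 + 2⌊n∕2⌋`, `c ≤ 2δ + 1`); D174's concavity (`δ ≤ 2⌊n∕2⌋`, `δ + 1 ≤ 2⌈n∕2⌉`, i.e. `δ + 1 ≤ n` — automatic in (R-b), where
`n ≥ 2δ + 1`) is needed only to BUILD `Jg` (★ `exists_subgroup_forall_mem_iff_twoDepth`) and is the caller's. [cite: Roche1998, §3, Lemma 3.2] [cite: Tits1979, §1.15]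
[cite: Serre1979, Ch. V §3] [cite: MoyPrasad1996, §3] -/
theorem theta_mul_twoDepth_wildRb (hn : 1 ≤ n) (χ₁ : (LocalRing L v)ˣ →* ℂˣ) {c : ℕ} (hc1 : 1 ≤ c) (hcδ : c ≤ 2 * δ + 1)
    (hcond : ∀ u : (LocalRing L v)ˣ, (∀ w' : PlacesOver L v, Valued.v (((u : LocalRing L v) w') - 1) ≤ Valued.v ϖ ^ n) → χ₁ u = 1)
    (hcondF : ∀ u : (LocalRing L v)ˣ, Units.map (conjLocal L (IsCMField.complexConj L) v : LocalRing L v →* LocalRing L v) u = u →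
      (∀ w' : PlacesOver L v, Valued.v (((u : LocalRing L v) w') - 1) ≤ Valued.v ϖ ^ c) → χ₁ u = 1)
    {t : w.1.adicCompletion L} (ht : t + galAdicCompletionMap (L := L) (IsCMField.complexConj L) hw t = 1)
    (hδ : Valued.v t * Valued.v ϖ ^ δ ≤ 1) :
    ∀ x ∈ Je, ∀ y ∈ Je,
      (if h : IsUnit ((((x * y : Gqs L v).val : GL (Fin 3) (LocalRing L v)) : Matrix (Fin 3) (Fin 3) (LocalRing L v)) 0 0) then ((χ₁ h.unit : ℂˣ) : ℂ) else 0) =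
        (if h : IsUnit (((x.val : GL (Fin 3) (LocalRing L v)) : Matrix (Fin 3) (Fin 3) (LocalRing L v)) 0 0) then ((χ₁ h.unit : ℂˣ) : ℂ) else 0) *
          (if h : IsUnit (((y.val : GL (Fin 3) (LocalRing L v)) : Matrix (Fin 3) (Fin 3) (LocalRing L v)) 0 0) then ((χ₁ h.unit : ℂˣ) : ℂ) else 0) :=
  theta_mul_twoDepth_of_defect L v w hw eA heA hϖ (n / 2) δ (n - n / 2) (δ + 1) Jg hJg Je hJe (by omega) (by omega) χ₁ hc1 hcond hcondF ht hδ
    (by omega) (by omega) (by omega) (by omega)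

end WildRb

end Summit.HodgeConjecture.HodgeConjecture.R90.S1.WildThetaMulFixCondDefectCM

end
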